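import Summits.NavierStokesRegularity.NavierStokesRegularity.Theorems.FilamentSkeletonRssCoreLinearInvertibilityRadialBlockToolsB
import Summits.NavierStokesRegularity.NavierStokesRegularity.Theorems.FilamentSkeletonRssCoreLinearInvertibilityRadialBlockToolsC
import Literature.Analysis.FluidPDE.GaussianWeightedSpace

/-!
# Route FilamentSkeletonRss · crux `CoreLinearInvertibility` (stmt-NavierStokesRegularity-17973) — line `Sketch`,
# stub `stub_radialBlock`: the radial block of the even sector

For the Gallay–Wayne operator `L = Δ + ½x·∇ + 1` (`strainedVorticityOperator 0`) and every
asymmetry `λ ∈ [0, 1)`: on RADIAL, compactly supported, `C²`, MASS-ZERO vorticities `w`,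

  `∫ G_λ⁻¹ ((1 + |x|²) w² + |x|² |∇w|²) ≤ C² ∫ G_λ⁻¹ (Lw)²`,  `G_λ⁻¹ = (4π/(1−λ)) e^{(1−λ)|x|²/4}`,

i.e. `L` is bounded below on the radial part of `X_λ = L²(G_λ⁻¹)` with graph control of `|x| w`
and `|x| ∇w` (the input for the coupling term `λ M w₀` of the even sector).

Proof (elementary, no spectral theory). In the radial variable `w = W(r)`, `L` is in divergence
form: `r (Lw)(r) = J′(r)` with the flux `J = rW′ + (r²/2)W` (tools C: `Δw = W″ + W′/r`,
`x·∇w = rW′`). With `β = 1 − λ ∈ (0, 1]` and `N = ∫₀^∞ e^{βr²/4} (Lw)² r dr`: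
(1) Hardy with the Gaussian weight, integrating by parts against `((2/β)e^{βr²/4})′ = r e^{βr²/4}`
and using `J(0) = J(∞) = 0`: `∫ e^{βr²/4} J² r ≤ (16/β²) N`; (2) `J(r)² ≤ (r²/2) N`;
(3) ZERO MASS pins the centre: `W(0) = −∫₀^∞ (W′ + (r/2)W)`, so `W(0)² ≲ N`; (4) the
first-order ODE `(e^{r²/4}W)′ = e^{r²/4} J/r` integrated from the centre bounds `W` on `[0, 4]`;
(5) in the far field `r ≥ 4` integrate `(e^{βr²/4} W² r^{2k})′` and substitute `rW′ = J − (r²/2)W`: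
the leading term `−(1 − β/2) e^{βr²/4} W² r^{2k+1}` has the good sign, which controls the
weighted moments `∫ e^{βr²/4} W² r^{2k+1}`, `k ≤ 2` (this is where the weight `G_λ⁻¹` excludes
the growing Kummer branch quantitatively); (6) `r²W′² ≤ 2J² + r⁴W²/2`. Tools A/B carry out
(1)–(6) in one variable (`radial_profile_bound`, constant `3·10⁵ e¹²/β²`); tools C transfers
between the plane and the ray (gradient and Laplacian of a radial function, polar coordinates).

References: Th. Gallay, C. E. Wayne, Comm. Math. Phys. 255 (2005), §4 and App. A (spectrum of `L`
in Gaussian and polynomial weights; the radial eigenfunctions `G Lₙ(r²/4)`); Th. Gallay,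
Y. Maekawa, arXiv:1610.08384, §2.2, (4.6).
-/

-- attempts log (worker, wave 3):
--   v1: one-variable Hardy/ODE route (tools A, B) + radial calculus transfer (tools C); no energy method
--       (the conjugated harmonic oscillator is not negative on radial mass-zero functions for λ near 1).

set_option linter.dupNamespace false

noncomputable section

namespace Summit.NavierStokesRegularity.NavierStokesRegularity.Theorems

open MeasureTheory Filter Topology Set
open Literature.Analysis.FluidPDE
open Summit.AnomalousDissipation.AnomalousDissipation.Theorems.MarginalStabilityChainStretchedVortexRows
open scoped InnerProductSpace Laplacian ContDiff

/-- `G_λ⁻¹ = (4π/(1−λ)) e^{(1−λ)|x|²/4}`. [folklore] -/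
theorem inv_gaussWeightLam_eq_mul_exp (lam : ℝ) (x : EuclideanSpace ℝ (Fin 2)) :
    (gaussWeightLam lam x)⁻¹ = 4 * Real.pi / (1 - lam) * Real.exp ((1 - lam) / 4 * ‖x‖ ^ 2) := by
  rw [gaussWeightLam, mul_inv, Real.exp_neg, inv_inv, inv_div]

/-- **The radial block with an explicit constant.** For `λ ∈ [0, 1)` and every radial, compactly
supported, `C²`, mass-zero `w`:
`∫ G_λ⁻¹ ((1 + |x|²) w² + |x|² ‖Dw‖²) ≤ (3·10⁵ e¹²/(1−λ)²) ∫ G_λ⁻¹ (Lw)²`. [folklore] -/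
theorem radialBlock_bound {lam : ℝ} (hlam : lam ∈ Set.Ico (0 : ℝ) 1)
    {w : EuclideanSpace ℝ (Fin 2) → ℝ} (hw : ContDiff ℝ 2 w) (hws : HasCompactSupport w)
    (hrad : ∀ x y : EuclideanSpace ℝ (Fin 2), ‖x‖ = ‖y‖ → w x = w y) (hmass : ∫ x, w x = 0) :
    ∫ x, (gaussWeightLam lam x)⁻¹ * ((1 + ‖x‖ ^ 2) * w x ^ 2 + ‖x‖ ^ 2 * ‖fderiv ℝ w x‖ ^ 2) ≤
      300000 * Real.exp 12 / (1 - lam) ^ 2 *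
        ∫ x, (gaussWeightLam lam x)⁻¹ * (strainedVorticityOperator 0 w x) ^ 2 := by
  obtain ⟨hl0, hl1⟩ := hlam
  set β : ℝ := 1 - lam with hβ
  have hβ0 : 0 < β := by rw [hβ]; linarith
  have hβ1 : β ≤ 1 := by rw [hβ]; linarith
  set e : EuclideanSpace ℝ (Fin 2) := EuclideanSpace.single 0 1 with he
  set W : ℝ → ℝ := fun s => w (s • e) with hW
  set W₁ : ℝ → ℝ := fun s => fderiv ℝ w (s • e) e with hW₁
  set W₂ : ℝ → ℝ := fun s => fderiv ℝ (fderiv ℝ w) (s • e) e e with hW₂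
  set F : ℝ → ℝ := fun s => strainedVorticityOperator 0 w (s • e) with hF
  set J : ℝ → ℝ := fun s => s * W₁ s + s ^ 2 / 2 * W s with hJ
  -- a support radius
  obtain ⟨R₀, hR₀⟩ := hws.isCompact.isBounded.subset_closedBall (0 : EuclideanSpace ℝ (Fin 2))
  set b : ℝ := max R₀ 3 + 1 with hb
  have hb4 : 4 ≤ b := by have := le_max_right R₀ 3; rw [hb]; linarith
  have hbR : R₀ < b := by have := le_max_left R₀ 3; rw [hb]; linarith
  have hb0 : (0 : ℝ) ≤ b := by linarith
  have hzero : ∀ x : EuclideanSpace ℝ (Fin 2), R₀ < ‖x‖ →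
      w x = 0 ∧ fderiv ℝ w x = 0 ∧ fderiv ℝ (fderiv ℝ w) x = 0 := by
    intro x hx
    have hx' : x ∉ tsupport w := fun h => by
      have h' := hR₀ h
      rw [Metric.mem_closedBall, dist_zero_right] at h'
      linarith
    exact ⟨image_eq_zero_of_notMem_tsupport hx',
      image_eq_zero_of_notMem_tsupport fun h => hx' (tsupport_fderiv_subset ℝ h),
      image_eq_zero_of_notMem_tsupport fun h => hx' (tsupport_fderiv_subset ℝ (tsupport_fderiv_subset ℝ h))⟩
  have hLzero : ∀ x : EuclideanSpace ℝ (Fin 2), R₀ < ‖x‖ → strainedVorticityOperator 0 w x = 0 := by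
    intro x hx
    obtain ⟨h0, h1, h2⟩ := hzero x hx
    rw [strainedVorticityOperator, laplacian_eq_sum_fderiv_fderiv (EuclideanSpace.basisFun (Fin 2) ℝ) hw x]
    simp [fderiv_partialDeriv_apply hw, h0, h1, h2]
  have hnorm_se : ∀ s : ℝ, 0 ≤ s → ‖s • e‖ = s := fun s hs => by
    rw [he, norm_smul_single_zero, abs_of_nonneg hs]
  have hWz : ∀ s : ℝ, R₀ < s → W s = 0 ∧ W₁ s = 0 ∧ F s = 0 := by
    intro s hs
    have hx : R₀ < ‖s • e‖ := by
      rw [he, norm_smul_single_zero]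
      exact hs.trans_le (le_abs_self s)
    obtain ⟨h0, h1, -⟩ := hzero _ hx
    exact ⟨h0, by simp [hW₁, h1], hLzero _ hx⟩
  -- the one-variable hypotheses
  have hWd : ∀ s, HasDerivAt W (W₁ s) s := fun s => hasDerivAt_radialProfile hw s
  have hW₁c : Continuous W₁ := continuous_radialProfile_deriv hw
  have hFc : Continuous F := continuous_radialProfile_op hw 0
  have hW₁0 : W₁ 0 = 0 := radialProfile_deriv_zero hrad
  have hFs : ∀ s : ℝ, 0 < s → F s = W₂ s + W₁ s / s + s / 2 * W₁ s + W s := by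
    intro s hs
    have hx : s • e ≠ 0 := fun h => by
      have h' := congrArg (fun z : EuclideanSpace ℝ (Fin 2) => ‖z‖) h
      simp only [hnorm_se s hs.le, norm_zero] at h'
      exact hs.ne' h'
    have h := strainedVorticityOperator_zero_radial hw hrad hx
    rw [hnorm_se s hs.le] at h
    exact h
  have hJ' : ∀ s ∈ Icc 0 b, HasDerivAt J (s * F s) s := by
    intro s hs
    have hd : HasDerivAt J (1 * W₁ s + s * W₂ s + (((2 : ℕ) : ℝ) * s ^ (2 - 1) / 2 * W s + s ^ 2 / 2 * W₁ s)) s :=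
      ((hasDerivAt_id' s).fun_mul (hasDerivAt_radialProfile_deriv hw s)).fun_add
        (((hasDerivAt_pow 2 s).div_const 2).fun_mul (hWd s))
    refine hd.congr_deriv ?_
    rcases hs.1.eq_or_lt with h0 | hpos
    · rw [← h0, hW₁0]
      simp
    · rw [hFs s hpos]
      field_simp
      push_cast
      ring
  have hWb : W b = 0 := (hWz b hbR).1
  have hW₁b : W₁ b = 0 := (hWz b hbR).2.1
  -- zero mass in the radial variable
  have hmass1 : ∫ r in 0..b, W r * r = 0 := by
    have h1 := integral_radial_eq_two_pi_mul (φ := W) (hw.continuous.integrable_of_hasCompactSupport hws)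
      fun x _ => radial_eq_profile hrad x
    rw [hmass, setIntegral_Ioi_eq_intervalIntegral hb0 fun r hr => by rw [(hWz r (hbR.trans hr)).1, zero_mul]]
      at h1
    have hpi : (2 * Real.pi) ≠ 0 := by positivity
    exact (mul_eq_zero.1 h1.symm).resolve_left hpi
  -- the one-variable bound
  have key := radial_profile_bound hβ0 hβ1 hb4 hWd hW₁c hFc (fun s => rfl) hJ' hWb hW₁b hmass1
  -- the weight
  have hGi : ∀ x : EuclideanSpace ℝ (Fin 2), (gaussWeightLam lam x)⁻¹ = 4 * Real.pi / β * Real.exp (β / 4 * ‖x‖ ^ 2) :=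
    fun x => inv_gaussWeightLam_eq_mul_exp lam x
  have hEc : Continuous fun x : EuclideanSpace ℝ (Fin 2) => 4 * Real.pi / β * Real.exp (β / 4 * ‖x‖ ^ 2) :=
    continuous_const.mul (Real.continuous_exp.comp (continuous_const.mul (continuous_norm.pow 2)))
  have hDc : Continuous (fderiv ℝ w) := hw.continuous_fderiv two_ne_zero
  -- left-hand side in the radial variable
  have hL : ∫ x, (gaussWeightLam lam x)⁻¹ * ((1 + ‖x‖ ^ 2) * w x ^ 2 + ‖x‖ ^ 2 * ‖fderiv ℝ w x‖ ^ 2) =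
      2 * Real.pi * (4 * Real.pi / β) *
        ∫ r in 0..b, Real.exp (β / 4 * r ^ 2) * ((1 + r ^ 2) * W r ^ 2 + r ^ 2 * W₁ r ^ 2) * r := by
    have hint : Integrable fun x => (gaussWeightLam lam x)⁻¹ *
        ((1 + ‖x‖ ^ 2) * w x ^ 2 + ‖x‖ ^ 2 * ‖fderiv ℝ w x‖ ^ 2) := by
      refine Continuous.integrable_of_hasCompactSupport ?_ ?_
      · simp_rw [hGi]
        exact hEc.mul (((continuous_const.add (continuous_norm.pow 2)).mul (hw.continuous.pow 2)).add
          ((continuous_norm.pow 2).mul (hDc.norm.pow 2)))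
      · refine HasCompactSupport.intro (isCompact_closedBall (0 : EuclideanSpace ℝ (Fin 2)) R₀) fun x hx => ?_
        rw [Metric.mem_closedBall, dist_zero_right, not_le] at hx
        obtain ⟨h0, h1, -⟩ := hzero x hx
        simp [h0, h1]
    rw [integral_radial_eq_two_pi_mul (φ := fun r => 4 * Real.pi / β *
        (Real.exp (β / 4 * r ^ 2) * ((1 + r ^ 2) * W r ^ 2 + r ^ 2 * W₁ r ^ 2))) hint fun x hx => by
        rw [hGi, radial_eq_profile hrad x, norm_fderiv_radial hw hrad hx, sq_abs]
        ring,
      setIntegral_Ioi_eq_intervalIntegral hb0 fun r hr => by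
        simp only [(hWz r (hbR.trans hr)).1, (hWz r (hbR.trans hr)).2.1]
        ring,
      ← intervalIntegral.integral_const_mul, ← intervalIntegral.integral_const_mul]
    exact intervalIntegral.integral_congr fun r _ => by ring
  -- right-hand side in the radial variable
  have hR : ∫ x, (gaussWeightLam lam x)⁻¹ * (strainedVorticityOperator 0 w x) ^ 2 =
      2 * Real.pi * (4 * Real.pi / β) * ∫ r in 0..b, Real.exp (β / 4 * r ^ 2) * F r ^ 2 * r := by
    have hint : Integrable fun x => (gaussWeightLam lam x)⁻¹ * (strainedVorticityOperator 0 w x) ^ 2 := by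
      refine Continuous.integrable_of_hasCompactSupport ?_ ?_
      · simp_rw [hGi]
        exact hEc.mul ((continuous_strainedVorticityOperator hw 0).pow 2)
      · refine HasCompactSupport.intro (isCompact_closedBall (0 : EuclideanSpace ℝ (Fin 2)) R₀) fun x hx => ?_
        rw [Metric.mem_closedBall, dist_zero_right, not_le] at hx
        simp [hLzero x hx]
    rw [integral_radial_eq_two_pi_mul (φ := fun r => 4 * Real.pi / β * (Real.exp (β / 4 * r ^ 2) * F r ^ 2))
        hint fun x hx => by
        have hr : 0 < ‖x‖ := norm_pos_iff.2 hx
        rw [hGi, strainedVorticityOperator_zero_radial hw hrad hx, hFs ‖x‖ hr]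
        ring,
      setIntegral_Ioi_eq_intervalIntegral hb0 fun r hr => by
        simp only [(hWz r (hbR.trans hr)).2.2]
        ring,
      ← intervalIntegral.integral_const_mul, ← intervalIntegral.integral_const_mul]
    exact intervalIntegral.integral_congr fun r _ => by ring
  rw [hL, hR]
  have hc : 0 ≤ 2 * Real.pi * (4 * Real.pi / β) := by positivity
  calc 2 * Real.pi * (4 * Real.pi / β) *
        ∫ r in 0..b, Real.exp (β / 4 * r ^ 2) * ((1 + r ^ 2) * W r ^ 2 + r ^ 2 * W₁ r ^ 2) * r
      ≤ 2 * Real.pi * (4 * Real.pi / β) *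
        (300000 * Real.exp 12 / β ^ 2 * ∫ r in 0..b, Real.exp (β / 4 * r ^ 2) * F r ^ 2 * r) :=
        mul_le_mul_of_nonneg_left key hc
    _ = _ := by ring

/-- **Stub `stub_radialBlock` of the skeleton of `CoreLinearInvertibility`, line `Sketch` (the RADIAL
block of the even sector).** The Gallay–Wayne operator `L = Δ + ½x·∇ + 1`
(`strainedVorticityOperator 0`) is bounded below, with graph control of `|x| w` and `|x| ∇w`, on
radial mass-zero `C²_c` vorticities in `X_λ = L²(G_λ⁻¹)`, for EVERY `λ ∈ [0, 1)`:
`∫ G_λ⁻¹((1 + |x|²)w² + |x|²‖Dw‖²) ≤ C² ∫ G_λ⁻¹ (Lw)²` (explicit inverse of the radial ODE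
`(r(W′ + (r/2)W))′ = r·Lw` with Gaussian-weight Hardy inequalities; `C = √(3·10⁵ e¹²)/(1−λ)`). [folklore] -/
theorem stub_radialBlock :
    ∀ lam ∈ Set.Ico (0 : ℝ) 1, ∃ C : ℝ, 0 ≤ C ∧
    ∀ w : EuclideanSpace ℝ (Fin 2) → ℝ, ContDiff ℝ 2 w → HasCompactSupport w →
    (∀ x y : EuclideanSpace ℝ (Fin 2), ‖x‖ = ‖y‖ → w x = w y) → ∫ x, w x = 0 →
    ∫ x, (gaussWeightLam lam x)⁻¹ * ((1 + ‖x‖ ^ 2) * w x ^ 2 + ‖x‖ ^ 2 * ‖fderiv ℝ w x‖ ^ 2) ≤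
      C ^ 2 * ∫ x, (gaussWeightLam lam x)⁻¹ * (strainedVorticityOperator 0 w x) ^ 2 := by
  intro lam hlam
  refine ⟨Real.sqrt (300000 * Real.exp 12 / (1 - lam) ^ 2), Real.sqrt_nonneg _, fun w hw hws hrad hmass => ?_⟩
  rw [Real.sq_sqrt (by positivity)]
  exact radialBlock_bound hlam hw hws hrad hmass

end Summit.NavierStokesRegularity.NavierStokesRegularity.Theorems
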